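import Mathlib
import HarnessLib
import Summits.Ventures.LatticeQCDFlow.Exactness.LatentBlockRefreshReversible

/-!
# LatticeQCDFlow / Exactness — RANDOM-SCAN MOVES IN FLOW SPACE: reversibility for the flow law is preserved by finite mixtures, so
# "pick a block of noise at random and refresh it" (or any random choice among `q`-reversible moves), read through the flow and
# accepted with the plain ratio, is exact

HONEST FRAMING: exact (Metropolis-corrected) sampling algorithms for lattice gauge theory;
figures of merit are autocorrelation/cost numbers at stated couplings and volumes; no
continuum-physics claim.

Venture `LatticeQCDFlow` (cell pub-lqcd), topic `Exactness`, FANOUT row 30 (lean-1 GEN-43, part II: MOVES IN FLOW SPACE; sequel of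
`IMHReversibleFlowProposals` ∕ `LatentReversibleProposals` ∕ `LatentBlockRefreshReversible`).  NEW WORK of the cell; no definition is introduced,
nothing is cited as a fact.  Printed counterpart NAMED ONLY: random-scan versus systematic-scan updates (Liu 2001 §5.3); the tree's finite
`KernelMixture` mixes `π`-invariant kernels — here the mixture is of PROPOSAL kernels under one accept/reject test.

## Results [all ours] (general measurable spaces; `q` the flow ∕ base law)

* **`isReversible_mixture_two`**: if `R₁`, `R₂` are `q`-reversible and `R(x, B) = p·R₁(x, B) + (1 − p)·R₂(x, B)`, then `R` is `q`-reversible;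
  **`isReversible_mixture_finset`**: the same for ANY finite family with weights `c_i ∈ [0, ∞]` (`R(x, B) = Σ_i c_i R_i(x, B)`); Markov when
  the weights sum to one and the components are Markov (`mixture_finset_apply_univ`).
* **`randomScanProposal_invariant`**: hence ANY kernel realising "choose move `i` with probability `c_i`, propose from the `q`-reversible `R_i`,
  accept with `min(1, w(y)/w(x))`, else stay" leaves `π = w·q` invariant (`revProposal_invariant`).
* **`randomBlockRefresh_invariant`**: the instance on a product base `γ₁ ⊗ γ₂` read through a flow bijection `e`: with probability `p` redraw
  the second noise block, else the first (`LatentBlockRefreshReversible` for each block, the first via the swap of factors) — exact.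
-/

namespace Summit.Ventures.LatticeQCDFlow.Exactness

open MeasureTheory ProbabilityTheory Finset
open scoped ENNReal

section Mixture

variable {Ω : Type*} [MeasurableSpace Ω] {q : Measure Ω}

/-- **Two-component mixtures of `q`-reversible kernels are `q`-reversible.** [ours] -/
theorem isReversible_mixture_two {p : ℝ≥0∞} (R₁ R₂ : Kernel Ω Ω) (h₁ : Kernel.IsReversible R₁ q) (h₂ : Kernel.IsReversible R₂ q)
    (R : Kernel Ω Ω) (hR : ∀ (x : Ω) {B : Set Ω}, MeasurableSet B → R x B = p * R₁ x B + (1 - p) * R₂ x B) :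
    Kernel.IsReversible R q := by
  intro A B hA hB
  simp_rw [hR _ hB, hR _ hA]
  rw [lintegral_add_left ((Kernel.measurable_coe R₁ hB).const_mul _), lintegral_add_left ((Kernel.measurable_coe R₁ hA).const_mul _),
    lintegral_const_mul _ (Kernel.measurable_coe R₁ hB), lintegral_const_mul _ (Kernel.measurable_coe R₁ hA),
    lintegral_const_mul _ (Kernel.measurable_coe R₂ hB), lintegral_const_mul _ (Kernel.measurable_coe R₂ hA), h₁ hA hB, h₂ hA hB]

/-- **Finite mixtures of `q`-reversible kernels are `q`-reversible**: `R(x, B) = Σ_i c_i R_i(x, B)`. [ours] -/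
theorem isReversible_mixture_finset {ι : Type*} (s : Finset ι) (c : ι → ℝ≥0∞) (Rs : ι → Kernel Ω Ω)
    (hRs : ∀ i ∈ s, Kernel.IsReversible (Rs i) q) (R : Kernel Ω Ω)
    (hR : ∀ (x : Ω) {B : Set Ω}, MeasurableSet B → R x B = ∑ i ∈ s, c i * Rs i x B) :
    Kernel.IsReversible R q := by
  intro A B hA hB
  simp_rw [hR _ hB, hR _ hA]
  rw [lintegral_finsetSum' _ fun i _ => ((Kernel.measurable_coe (Rs i) hB).const_mul _).aemeasurable,
    lintegral_finsetSum' _ fun i _ => ((Kernel.measurable_coe (Rs i) hA).const_mul _).aemeasurable]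
  refine Finset.sum_congr rfl fun i hi => ?_
  rw [lintegral_const_mul _ (Kernel.measurable_coe (Rs i) hB), lintegral_const_mul _ (Kernel.measurable_coe (Rs i) hA), hRs i hi hA hB]

/-- A finite mixture with weights summing to one of Markov kernels is Markov. [ours, bookkeeping] -/
theorem mixture_finset_apply_univ {ι : Type*} (s : Finset ι) (c : ι → ℝ≥0∞) (hc : ∑ i ∈ s, c i = 1) (Rs : ι → Kernel Ω Ω)
    (hM : ∀ i ∈ s, IsMarkovKernel (Rs i)) (R : Kernel Ω Ω)
    (hR : ∀ (x : Ω) {B : Set Ω}, MeasurableSet B → R x B = ∑ i ∈ s, c i * Rs i x B) (x : Ω) : R x Set.univ = 1 := by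
  rw [hR x MeasurableSet.univ, ← hc]
  refine Finset.sum_congr rfl fun i hi => ?_
  haveI := hM i hi
  rw [measure_univ, mul_one]

variable [IsProbabilityMeasure q] {w : Ω → ℝ}

/-- **RANDOM-SCAN MOVES IN FLOW SPACE ARE EXACT**: choose move `i ∈ s` with probability `c_i` (`Σ c_i = 1`), propose from the `q`-reversible
Markov kernel `R_i`, accept with `min(1, w(y)/w(x))`, else stay — `π = w·q` is invariant. [ours] -/
theorem randomScanProposal_invariant (hw : Measurable w) (hw0 : ∀ x, 0 < w x) {ι : Type*} (s : Finset ι) (c : ι → ℝ≥0∞)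
    (hc : ∑ i ∈ s, c i = 1) (Rs : ι → Kernel Ω Ω) (hM : ∀ i ∈ s, IsMarkovKernel (Rs i))
    (hRs : ∀ i ∈ s, Kernel.IsReversible (Rs i) q) (R : Kernel Ω Ω)
    (hR : ∀ (x : Ω) {B : Set Ω}, MeasurableSet B → R x B = ∑ i ∈ s, c i * Rs i x B) (K : Kernel Ω Ω)
    (hK : ∀ (x : Ω) {B : Set Ω}, MeasurableSet B → K x B =
      ∫⁻ y in B, imhAcceptE w x y ∂(R x) + (1 - ∫⁻ y, imhAcceptE w x y ∂(R x)) * B.indicator 1 x) :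
    Kernel.Invariant K (q.withDensity fun x => ENNReal.ofReal (w x)) := by
  haveI : IsMarkovKernel R := ⟨fun x => ⟨mixture_finset_apply_univ s c hc Rs hM R hR x⟩⟩
  exact revProposal_invariant hw hw0 R (isReversible_mixture_finset s c Rs hRs R hR) K hK

end Mixture

/-! ## The instance: refresh a randomly chosen block of noise -/

section RandomBlock

variable {Z₁ Z₂ Ω : Type*} [MeasurableSpace Z₁] [MeasurableSpace Z₂] [MeasurableSpace Ω] {γ₁ : Measure Z₁} {γ₂ : Measure Z₂}
  [IsProbabilityMeasure γ₁] [IsProbabilityMeasure γ₂] {w : Ω → ℝ}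

/-- **Refreshing the FIRST block is `γ₁ ⊗ γ₂`-reversible too** (conjugate the second-block statement by the swap of factors). [ours] -/
theorem blockRefreshFst_isReversible (S : Kernel (Z₁ × Z₂) (Z₁ × Z₂))
    (hS : ∀ (z : Z₁ × Z₂) {B : Set (Z₁ × Z₂)}, MeasurableSet B → S z B = γ₁ ((fun z₁ => (z₁, z.2)) ⁻¹' B)) :
    Kernel.IsReversible S (γ₁.prod γ₂) := by
  -- the swap `e : Z₂ × Z₁ ≃ᵐ Z₁ × Z₂` carries `γ₂ ⊗ γ₁` to `γ₁ ⊗ γ₂` and the second-block refresh of `γ₂ ⊗ γ₁` to `S`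
  have hmap : (γ₂.prod γ₁).map (MeasurableEquiv.prodComm : Z₂ × Z₁ ≃ᵐ Z₁ × Z₂) = γ₁.prod γ₂ :=
    Measure.prod_swap
  obtain ⟨S', hS'⟩ := blockRefresh_exists (Z₁ := Z₂) (γ₂ := γ₁)
  rw [← hmap]
  refine conj_isReversible MeasurableEquiv.prodComm S' (blockRefresh_isReversible S' hS') S (fun x B hB => ?_)
  rw [hS x hB, hS' _ (MeasurableEquiv.prodComm.measurable hB)]
  rfl

/-- **RANDOM-BLOCK PARTIAL REFRESH THROUGH THE FLOW IS EXACT**: product base `γ₁ ⊗ γ₂`, flow bijection `e`, weight `w > 0`; with probability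
`p` redraw the second noise block (`S₂`), else the first (`S₁`); push forward; accept with `min(1, w(y)/w(x))`: `π = w·((γ₁ ⊗ γ₂).map e)` is
invariant. [ours] -/
theorem randomBlockRefresh_invariant (hw : Measurable w) (hw0 : ∀ x, 0 < w x) (e : Z₁ × Z₂ ≃ᵐ Ω) {p : ℝ≥0∞} (hp : p ≤ 1)
    (S₁ S₂ : Kernel (Z₁ × Z₂) (Z₁ × Z₂))
    (hS₁ : ∀ (z : Z₁ × Z₂) {B : Set (Z₁ × Z₂)}, MeasurableSet B → S₁ z B = γ₁ ((fun z₁ => (z₁, z.2)) ⁻¹' B))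
    (hS₂ : ∀ (z : Z₁ × Z₂) {B : Set (Z₁ × Z₂)}, MeasurableSet B → S₂ z B = γ₂ (Prod.mk z.1 ⁻¹' B))
    (S : Kernel (Z₁ × Z₂) (Z₁ × Z₂))
    (hS : ∀ (z : Z₁ × Z₂) {B : Set (Z₁ × Z₂)}, MeasurableSet B → S z B = p * S₂ z B + (1 - p) * S₁ z B) (R : Kernel Ω Ω)
    (hR : ∀ (x : Ω) {B : Set Ω}, MeasurableSet B → R x B = S (e.symm x) (e ⁻¹' B)) (K : Kernel Ω Ω)
    (hK : ∀ (x : Ω) {B : Set Ω}, MeasurableSet B → K x B =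
      ∫⁻ y in B, imhAcceptE w x y ∂(R x) + (1 - ∫⁻ y, imhAcceptE w x y ∂(R x)) * B.indicator 1 x) :
    Kernel.Invariant K (((γ₁.prod γ₂).map e).withDensity fun x => ENNReal.ofReal (w x)) := by
  have hrev : Kernel.IsReversible S (γ₁.prod γ₂) :=
    isReversible_mixture_two S₂ S₁ (blockRefresh_isReversible S₂ hS₂) (blockRefreshFst_isReversible S₁ hS₁) S hS
  haveI : IsMarkovKernel S := ⟨fun z => ⟨by
    rw [hS z MeasurableSet.univ, hS₁ z MeasurableSet.univ, hS₂ z MeasurableSet.univ, Set.preimage_univ, Set.preimage_univ,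
      measure_univ, measure_univ, mul_one, mul_one, add_tsub_cancel_of_le hp]⟩⟩
  exact latentProposal_invariant hw hw0 e S hrev R hR K hK

end RandomBlock

end Summit.Ventures.LatticeQCDFlow.Exactness
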